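import Literature.AlgebraicGeometry.Frobenioids.BiratPreservesUnits
import Literature.AlgebraicGeometry.Frobenioids.BirationalizationPreModel
import Literature.AlgebraicGeometry.Frobenioids.PreFrobenioidPullbacks
import Literature.AlgebraicGeometry.Frobenioids.BirationalizationBaseIdentity
import Literature.AlgebraicGeometry.Frobenioids.BirationalizationIsos
import HarnessLib

/-!
# Frobenioids I, Corollary 4.11 (ii), sub-node L11 for an ARBITRARY equivalence of the
# birationalizations lying over `Ψ` (the quantifier of the named fact `FrdI.BiratEquivPreservesUnits`)

Mochizuki, *The geometry of Frobenioids I: the general theory*, Kyushu J. Math. **62** (2008)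
293–400, proof of Cor. 4.11 (ii), kurims text p. 93 ll. 30–46 [cite: MochizukiFrdI2008, Cor. 4.11 (ii) p.93]:

> "by Corollary 4.10, `Ψ` induces a 1-unique equivalence `Ψ^birat : C₁^birat ⥲ C₂^birat` … Thus, since `D_i`
> is Div-slim, the base-identity endomorphisms of `A ∈ Ob(C_i^birat)` may be characterized as the
> endomorphisms of `A` that arise from endomorphisms `φ ∈ End((C_i^birat)^pl-bk_A → C_i^birat)` such that
> every endomorphism induced by `φ` projects to an automorphism of `D_i` that is mapped by `Φ_i` to an
> identity automorphism. … we thus conclude that `Ψ^birat` preserves the base-identity endomorphisms [hence,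
> in particular, that `Ψ^birat` preserves '`O^×(−)`']."

PROOF-ONLY file (seat abc-iut-w4-d109; L1 lead R68/R75, MENU M1 = the S2 closer of `Cor411Sub.lean` v2,
seat abc-iut-L1-d6). The named fact `FrdI.BiratEquivPreservesUnits` quantifies over EVERY equivalence
`E : C₁^birat ⥲ C₂^birat` lying over `Ψ` (`(C₁ → C₁^birat) ⋙ E ≅ Ψ ⋙ (C₂ → C₂^birat)`), whereas the landed
transport `PreFrobenioid.Birat.mapIso_mem_unitsSubgroup_mapOfEquiv` (abc-iut-L1-d4, p411215) and its
inputs speak about THE lift `Ψ^birat = Birat.mapOfEquiv` (Cor. 4.10, abc-iut-L1-t10). This file removes the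
difference ("1-unique", Cor. 4.10, p. 91): by the uniqueness of lifts along the localization `C₁ → C₁^birat`
(`Birat.nonempty_iso_mapOfEquiv`), `E ≅ Ψ^birat` and `E⁻¹ ≅ (Ψ⁻¹)^birat` (the square for `E⁻¹` over `Ψ⁻¹` is
derived from the one for `E`, `Birat.oneCommutes_inverse_of_over`), and the two properties the printed
argument transports — "carries pull-back morphisms to pull-back morphisms", "carries endomorphisms
projecting to `Φ`-identities to endomorphisms projecting to `Φ`-identities" — are invariant under
isomorphism of functors (`map_isPullbackMorphism_of_natIso`, `pull_base_map_of_natIso`). Hence, for every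
such `E`, BOTH `E` and `E⁻¹` preserve `O^×(−)` (`Birat.mapIso_mem_unitsSubgroup_of_over`), from the printed
inputs as NAMED HYPOTHESES about `Ψ^birat` and `(Ψ⁻¹)^birat`: Thm. 3.4 (ii) (`Ψ`, `Ψ⁻¹` preserve
co-angular pre-steps), `D_i` Div-slim, "`Ψ^birat`, `(Ψ⁻¹)^birat` preserve pull-back morphisms" (p. 93
ll. 31–35: base-isomorphisms by sub-node L10, abc-iut-L6-t20 p411120, + Prop. 1.7 (ii)), and the Thm. 4.2
(ii) transport of `Φ`-identity endomorphisms; the remaining input of that transport, Def. 1.3 (i)(c) for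
`C_i^birat → F_{0_{D_i}}` (part of Prop. 4.4 (ii) "`C^birat` is a Frobenioid"), is PROVED here for every
Frobenioid (`Birat.pullbackSliceToBase_toElemZero_isEquivalence`). In print's reduced case (isotropic type,
p. 92 ll. 1–8) the pull-back input is PROVED too: pull-back morphisms of `C^birat` are exactly its linear
morphisms (`Birat.isLinear_of_isPullbackMorphism_toElemZero`, `isPullbackMorphism_of_isLinear_toElemZero`;
Def. 1.3 (iv)(a), Prop. 4.4 (iv), Rem. 1.2.1), and `Ψ^birat` preserves linear morphisms when `Ψ` does
(`isLinear_mapOfEquiv_map`, by the square of Cor. 4.10) — whence `mapIso_mem_unitsSubgroup_of_over_of_isotropic`,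
whose only inputs beyond Thm. 3.4 (ii)/(iii) and Div-slimness are the Thm. 4.2 (ii) transports. Nothing of
[FrdI] is restated; no new definitions; nothing here is specific to the abc programme.
-/

namespace Literature.AlgebraicGeometry.Frobenioids

open CategoryTheory Opposite

universe w w' v v' u u'

namespace PreFrobenioid

/-! ### Two functor properties invariant under isomorphism of functors -/

section NatIso

variable {D₁ : Type u} [Category.{v} D₁] {Θ₁ : D₁ᵒᵖ ⥤ CommMonCat.{w}} {Φ₁ : D₁ᵒᵖ ⥤ CommMonCat.{w'}}
  {C₁ : Type u'} [Category.{v'} C₁]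
  {D₂ : Type u} [Category.{v} D₂] {Θ₂ : D₂ᵒᵖ ⥤ CommMonCat.{w}} {Φ₂ : D₂ᵒᵖ ⥤ CommMonCat.{w'}}
  {C₂ : Type u'} [Category.{v'} C₂]

/-- For isomorphic functors `G ≅ G'`: `G'(δ) = η⁻¹ ∘ G(δ) ∘ η`. [cite: MochizukiFrdI2008, Cor. 4.10 p.91] -/
theorem map_eq_conj_of_natIso {G G' : C₁ ⥤ C₂} (η : G ≅ G') {X Y : C₁} (δ : X ⟶ Y) :
    G'.map δ = η.inv.app X ≫ G.map δ ≫ η.hom.app Y := by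
  rw [η.hom.naturality δ, ← Category.assoc, Iso.inv_hom_id_app, Category.id_comp]

/-- "Carries pull-back morphisms to pull-back morphisms" is invariant under isomorphism of functors
(isomorphisms are pull-back morphisms, and pull-back morphisms compose; FrdI Rem. 1.2.1 p. 24).
[cite: MochizukiFrdI2008, Rem. 1.2.1 p.24] -/
theorem map_isPullbackMorphism_of_natIso (G₁ : C₁ ⥤ ElemFrobenioid Θ₁) (G₂ : C₂ ⥤ ElemFrobenioid Θ₂)
    {G G' : C₁ ⥤ C₂} (η : G ≅ G')
    (h : ∀ ⦃X Y : C₁⦄ (δ : X ⟶ Y), IsPullbackMorphism G₁ δ → IsPullbackMorphism G₂ (G.map δ))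
    ⦃X Y : C₁⦄ (δ : X ⟶ Y) (hδ : IsPullbackMorphism G₁ δ) : IsPullbackMorphism G₂ (G'.map δ) := by
  rw [map_eq_conj_of_natIso η δ]
  haveI : IsIso (η.inv.app X) := ⟨⟨η.hom.app X, η.inv_hom_id_app X, η.hom_inv_id_app X⟩⟩
  haveI : IsIso (η.hom.app Y) := ⟨⟨η.inv.app Y, η.hom_inv_id_app Y, η.inv_hom_id_app Y⟩⟩
  exact IsPullbackMorphism.comp G₂ (isPullbackMorphism_of_isIso G₂ (η.inv.app X))
    (IsPullbackMorphism.comp G₂ (h δ hδ) (isPullbackMorphism_of_isIso G₂ (η.hom.app Y)))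

/-- "Carries endomorphisms projecting to `Φ₁`-identity automorphisms to endomorphisms projecting to
`Φ₂`-identity automorphisms" is invariant under isomorphism of functors (conjugation by an isomorphism,
`pull_base_conj_iso`). [cite: MochizukiFrdI2008, Cor. 4.11 (ii) p.93] -/
theorem pull_base_map_of_natIso (G₁ : C₁ ⥤ ElemFrobenioid Θ₁) (G₂ : C₂ ⥤ ElemFrobenioid Θ₂)
    {G G' : C₁ ⥤ C₂} (η : G ≅ G')
    (h : ∀ (X : C₁) (φ : X ⟶ X), pull Φ₁ (Base G₁ φ) = MonoidHom.id _ →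
      pull Φ₂ (Base G₂ (G.map φ)) = MonoidHom.id _)
    (X : C₁) (φ : X ⟶ X) (hφ : pull Φ₁ (Base G₁ φ) = MonoidHom.id _) :
    pull Φ₂ (Base G₂ (G'.map φ)) = MonoidHom.id _ := by
  rw [map_eq_conj_of_natIso η φ]
  exact pull_base_conj_iso (h X φ hφ) (η.app X)

end NatIso

namespace Birat

section One

variable {D : Type u} [Category.{v} D] {Φ : Dᵒᵖ ⥤ CommMonCat.{w}}
  {C : Type u'} [Category.{v'} C] {F : C ⥤ ElemFrobenioid Φ}

/-- **Def. 1.3 (i)(c) for the birationalization** `C^birat → F_{0_D}` of a Frobenioid `C`: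
`(C^birat)^pl-bk_B → D_{B_D}` is an equivalence of categories. Full and faithful hold in every
pre-Frobenioid (`pullbackSliceToBase_full/faithful`); essential surjectivity: every arrow `X₀ → B_D` of `D`
is the base of a pull-back morphism `Y → B` of `C` (Def. 1.3 (i)(c) for `C`), whose image in `C^birat` is a
pull-back morphism with the same base (Prop. 4.4 (iv), `isPullbackMorphism_toBirat_map`). This is the
Def. 1.3 (i)(c) input (`hic`) of the transport of units along `Ψ^birat` (`mapIso_mem_unitsSubgroup_of_pull_eq`).
[cite: MochizukiFrdI2008, Prop. 4.4 (ii) p.83] -/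
theorem pullbackSliceToBase_toElemZero_isEquivalence (hF : IsFrobenioid F) (hsq : HasBiratSquares F)
    (B : Birat F hF hsq) : (pullbackSliceToBase (Birat.toElemZero hF hsq) B).IsEquivalence := by
  haveI := pullbackSliceToBase_faithful (Birat.toElemZero hF hsq) B
  haveI := pullbackSliceToBase_full (Birat.toElemZero hF hsq) B
  refine { faithful := inferInstance, full := inferInstance, essSurj := ⟨fun W => ?_⟩ }
  haveI := hF.i_c B.out
  obtain ⟨P, ⟨e⟩⟩ := Functor.EssSurj.mem_essImage (pullbackSliceToBase F B.out)
    (Over.mk (W.hom : _ ⟶ baseObj F B.out))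
  have hψ : IsPullbackMorphism (Birat.toElemZero hF hsq) ((toBirat F hF hsq).map P.hom.1) :=
    (isPullbackMorphism_toElemZero_iff _).mpr (isPullbackMorphism_toBirat_map (hF := hF) (hsq := hsq) P.hom.2)
  let V : Over (⟨B⟩ : PullbackCat (Birat.toElemZero hF hsq)) :=
    Over.mk (Y := ⟨(toBirat F hF hsq).obj P.left.obj⟩) ⟨(toBirat F hF hsq).map P.hom.1, hψ⟩
  refine ⟨V, ⟨Over.isoMk ((Over.forget _).mapIso e) ?_⟩⟩
  have hw : e.hom.left ≫ W.hom = Base F P.hom.1 := Over.w e.hom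
  change e.hom.left ≫ W.hom = Base (Birat.toElemZero hF hsq) ((toBirat F hF hsq).map P.hom.1)
  rw [base_toElemZero_map]
  exact hw

variable {hF : IsFrobenioid F} {hsq : HasBiratSquares F}

/-- In `C^birat` of a Frobenioid `C` of ISOTROPIC type, pull-back morphisms are linear (the analogue of
Def. 1.3 (iv)(b) for `C^birat`): write `g = (α^birat)⁻¹ ∘ φ′^birat` with `α` a co-angular pre-step and
factor `φ′ = pull-back ∘ pre-step ∘ Frobenius-type` in `C` (Def. 1.3 (iv)(a)); the pre-step is co-angular
(isotropic type), hence invertible in `C^birat` (Prop. 4.4 (iv)), so by two-out-of-three the image of the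
Frobenius-type factor is a pull-back morphism AND a base-isomorphism of `C^birat`, hence an isomorphism
(Rem. 1.2.1), hence linear. [cite: MochizukiFrdI2008, Prop. 4.4 (iv) p.83] -/
theorem isLinear_of_isPullbackMorphism_toElemZero (hiso : IsOfIsotropicType F) {A B : C}
    {g : (toBirat F hF hsq).obj A ⟶ (toBirat F hF hsq).obj B}
    (hg : IsPullbackMorphism (Birat.toElemZero hF hsq) g) : IsLinear (Birat.toElemZero hF hsq) g := by
  obtain ⟨f, rfl⟩ := exists_homMk_eq g
  rw [isLinear_homMk_iff]
  haveI := toBirat_inverts hF hsq f.den f.den_mem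
  have h1 : (toBirat F hF hsq).map f.num =
      (toBirat F hF hsq).map f.den ≫ (homMk f : (toBirat F hF hsq).obj A ⟶ (toBirat F hF hsq).obj B) := by
    rw [homMk_eq_inv_comp f, IsIso.hom_inv_id_assoc]
  have hnum : IsPullbackMorphism (Birat.toElemZero hF hsq) ((toBirat F hF hsq).map f.num) := by
    rw [h1]
    exact IsPullbackMorphism.comp _ (isPullbackMorphism_of_isIso _ _) hg
  -- Def. 1.3 (iv)(a) for `φ′ = f.num`
  obtain ⟨X₁, Y₁, γ, β, α, hfac, hγ, hβ, hα⟩ := hF.iv_a_exists f.num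
  have hβc : IsCoAngularPreStep F β := ⟨isCoAngular_of_isIsotropic_codomains F β fun X _ => hiso X, hβ⟩
  haveI := isIso_toBirat_map (hF := hF) (hsq := hsq) β hβc
  have hα' : IsPullbackMorphism (Birat.toElemZero hF hsq) ((toBirat F hF hsq).map α) :=
    (isPullbackMorphism_toElemZero_iff _).mpr (isPullbackMorphism_toBirat_map hα)
  have hβα : IsPullbackMorphism (Birat.toElemZero hF hsq) ((toBirat F hF hsq).map (β ≫ α)) := by
    rw [Functor.map_comp]
    exact IsPullbackMorphism.comp _ (isPullbackMorphism_of_isIso _ _) hα'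
  have hγ' : IsPullbackMorphism (Birat.toElemZero hF hsq) ((toBirat F hF hsq).map γ) := by
    refine IsPullbackMorphism.of_comp (Birat.toElemZero hF hsq) hβα ?_
    rw [← Functor.map_comp, hfac]
    exact hnum
  have hγbi : IsBaseIso (Birat.toElemZero hF hsq) ((toBirat F hF hsq).map γ) :=
    isBaseIso_toElemZero_map hγ.2
  haveI : IsIso ((toBirat F hF hsq).map γ) :=
    (isPullbackMorphism_and_isBaseIso_iff_isIso _ _).mp ⟨hγ', hγbi⟩
  have hγlin : IsLinear F γ := isLinear_of_isIso (Birat.toElemZero hF hsq) ((toBirat F hF hsq).map γ)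
  change degFr F f.num = 1
  rw [← hfac, degFr_comp, degFr_comp, show degFr F γ = 1 from hγlin, show degFr F β = 1 from hβ.1,
    show degFr F α = 1 from (hF.iv_b α hα).2, one_mul, one_mul]

/-- Conversely, in `C^birat` of a Frobenioid of isotropic type every LINEAR morphism is a pull-back morphism
(`g = (α^birat)⁻¹ ∘ φ′^birat` with `φ′` linear, and `φ′^birat` is a pull-back morphism, Prop. 4.4 (iv)).
[cite: MochizukiFrdI2008, Prop. 4.4 (iv) p.83] -/
theorem isPullbackMorphism_of_isLinear_toElemZero (hiso : IsOfIsotropicType F) {A B : C}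
    {g : (toBirat F hF hsq).obj A ⟶ (toBirat F hF hsq).obj B} (hg : IsLinear (Birat.toElemZero hF hsq) g) :
    IsPullbackMorphism (Birat.toElemZero hF hsq) g := by
  obtain ⟨f, rfl⟩ := exists_homMk_eq g
  rw [isLinear_homMk_iff] at hg
  haveI := toBirat_inverts hF hsq f.den f.den_mem
  rw [homMk_eq_inv_comp f]
  exact IsPullbackMorphism.comp _ (isPullbackMorphism_of_isIso _ _)
    ((isPullbackMorphism_toElemZero_iff _).mpr (isPullbackMorphism_toBirat_map_of_isotropic hiso hg))

end One

variable {D₁ : Type u} [Category.{v} D₁] {Φ₁ : D₁ᵒᵖ ⥤ CommMonCat.{w}}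
  {C₁ : Type u'} [Category.{v'} C₁] {F₁ : C₁ ⥤ ElemFrobenioid Φ₁}
  {D₂ : Type u} [Category.{v} D₂] {Φ₂ : D₂ᵒᵖ ⥤ CommMonCat.{w}}
  {C₂ : Type u'} [Category.{v'} C₂] {F₂ : C₂ ⥤ ElemFrobenioid Φ₂}

/-- If an equivalence `E : C₁^birat ⥲ C₂^birat` lies over `Ψ` (`(C₁ → C₁^birat) ⋙ E ≅ Ψ ⋙ (C₂ → C₂^birat)`),
then its quasi-inverse lies over `Ψ⁻¹`: `Ψ⁻¹ ⋙ (C₁ → C₁^birat) ≅ (C₂ → C₂^birat) ⋙ E⁻¹` (whiskering with the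
unit of `E` and the counit of `Ψ`). [cite: MochizukiFrdI2008, Cor. 4.10 p.91] -/
theorem oneCommutes_inverse_of_over (hF₁ : IsFrobenioid F₁) (hsq₁ : HasBiratSquares F₁)
    (hF₂ : IsFrobenioid F₂) (hsq₂ : HasBiratSquares F₂) (Ψ : C₁ ≌ C₂)
    (E : Birat F₁ hF₁ hsq₁ ≌ Birat F₂ hF₂ hsq₂)
    (sq : toBirat F₁ hF₁ hsq₁ ⋙ E.functor ≅ Ψ.functor ⋙ toBirat F₂ hF₂ hsq₂) :
    OneCommutes Ψ.symm.functor (toBirat F₁ hF₁ hsq₁) (toBirat F₂ hF₂ hsq₂) E.inverse := by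
  -- `(C₂ → C₂^birat) ⋙ E⁻¹ ≅ Ψ⁻¹ ⋙ Ψ ⋙ (C₂ → C₂^birat) ⋙ E⁻¹ ≅ Ψ⁻¹ ⋙ (C₁ → C₁^birat) ⋙ E ⋙ E⁻¹ ≅ Ψ⁻¹ ⋙ (C₁ → C₁^birat)`
  refine ⟨Iso.symm ?_⟩
  exact (Functor.leftUnitor _).symm ≪≫ Functor.isoWhiskerRight Ψ.counitIso.symm _ ≪≫
    Functor.associator _ _ _ ≪≫
      Functor.isoWhiskerLeft Ψ.inverse
        ((Functor.associator _ _ _).symm ≪≫ Functor.isoWhiskerRight sq.symm _ ≪≫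
          Functor.associator _ _ _ ≪≫ Functor.isoWhiskerLeft _ E.unitIso.symm ≪≫ Functor.rightUnitor _)

/-- **`Ψ^birat` preserves linear morphisms** when `Ψ` does (Thm. 3.4 (iii)): `Ψ^birat((α^birat)⁻¹ ∘ φ′^birat)
= (Ψ^birat α^birat)⁻¹ ∘ Ψ^birat φ′^birat` and, by the 1-commutative square of Cor. 4.10,
`Ψ^birat(φ′^birat) ≅ (Ψ φ′)^birat`. [cite: MochizukiFrdI2008, Cor. 4.10 p.91] -/
theorem isLinear_mapOfEquiv_map (hF₁ : IsFrobenioid F₁) (hsq₁ : HasBiratSquares F₁)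
    (hF₂ : IsFrobenioid F₂) (hsq₂ : HasBiratSquares F₂) (Ψ : C₁ ≌ C₂)
    (hΨ : ∀ ⦃A B : C₁⦄ (f : A ⟶ B), IsCoAngularPreStep F₁ f → IsCoAngularPreStep F₂ (Ψ.functor.map f))
    (hlin : ∀ ⦃A B : C₁⦄ (f : A ⟶ B), IsLinear F₁ f → IsLinear F₂ (Ψ.functor.map f))
    {A B : C₁} {g : (toBirat F₁ hF₁ hsq₁).obj A ⟶ (toBirat F₁ hF₁ hsq₁).obj B}
    (hg : IsLinear (Birat.toElemZero hF₁ hsq₁) g) :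
    IsLinear (Birat.toElemZero hF₂ hsq₂) ((mapOfEquiv hF₁ hsq₁ hF₂ hsq₂ Ψ hΨ).map g) := by
  obtain ⟨f, rfl⟩ := exists_homMk_eq g
  rw [isLinear_homMk_iff] at hg
  haveI := toBirat_inverts hF₁ hsq₁ f.den f.den_mem
  rw [homMk_eq_inv_comp f, Functor.map_comp, Functor.map_inv]
  let e := mapOfEquivFac hF₁ hsq₁ hF₂ hsq₂ Ψ hΨ
  haveI : IsIso (e.hom.app f.src) := ⟨⟨e.inv.app f.src, e.hom_inv_id_app f.src, e.inv_hom_id_app f.src⟩⟩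
  haveI : IsIso (e.inv.app B) := ⟨⟨e.hom.app B, e.inv_hom_id_app B, e.hom_inv_id_app B⟩⟩
  have nat := e.hom.naturality f.num
  have h1 : (mapOfEquiv hF₁ hsq₁ hF₂ hsq₂ Ψ hΨ).map ((toBirat F₁ hF₁ hsq₁).map f.num) =
      ((toBirat F₁ hF₁ hsq₁ ⋙ mapOfEquiv hF₁ hsq₁ hF₂ hsq₂ Ψ hΨ).map f.num ≫ e.hom.app B) ≫
        e.inv.app B := by
    simp only [Functor.comp_map, Category.assoc, Iso.hom_inv_id_app, Category.comp_id]
  rw [h1, nat]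
  have hmid : IsLinear (Birat.toElemZero hF₂ hsq₂) ((Ψ.functor ⋙ toBirat F₂ hF₂ hsq₂).map f.num) :=
    hlin f.num hg
  exact IsLinear.comp _
    (isLinear_of_isIso _ (inv ((mapOfEquiv hF₁ hsq₁ hF₂ hsq₂ Ψ hΨ).map ((toBirat F₁ hF₁ hsq₁).map f.den))))
    (IsLinear.comp _ (IsLinear.comp _ (isLinear_of_isIso _ (e.hom.app f.src)) hmid)
      (isLinear_of_isIso _ (e.inv.app B)))

/-- **`Ψ^birat` preserves pull-back morphisms** for Frobenioids of ISOTROPIC type when `Ψ` preserves linear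
morphisms (proof of Cor. 4.11 (ii), p. 93 ll. 31–35, in print via base-isomorphisms and Prop. 1.7 (ii); here:
pull-back morphisms of `C^birat` = linear morphisms of `C^birat` in isotropic type).
[cite: MochizukiFrdI2008, Cor. 4.11 (ii) p.93] -/
theorem isPullbackMorphism_mapOfEquiv_map (hF₁ : IsFrobenioid F₁) (hsq₁ : HasBiratSquares F₁)
    (hF₂ : IsFrobenioid F₂) (hsq₂ : HasBiratSquares F₂) (Ψ : C₁ ≌ C₂)
    (hΨ : ∀ ⦃A B : C₁⦄ (f : A ⟶ B), IsCoAngularPreStep F₁ f → IsCoAngularPreStep F₂ (Ψ.functor.map f))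
    (hiso₁ : IsOfIsotropicType F₁) (hiso₂ : IsOfIsotropicType F₂)
    (hlin : ∀ ⦃A B : C₁⦄ (f : A ⟶ B), IsLinear F₁ f → IsLinear F₂ (Ψ.functor.map f))
    ⦃X Y : Birat F₁ hF₁ hsq₁⦄ (δ : X ⟶ Y) (hδ : IsPullbackMorphism (Birat.toElemZero hF₁ hsq₁) δ) :
    IsPullbackMorphism (Birat.toElemZero hF₂ hsq₂) ((mapOfEquiv hF₁ hsq₁ hF₂ hsq₂ Ψ hΨ).map δ) :=
  isPullbackMorphism_of_isLinear_toElemZero hiso₂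
    (A := ((mapOfEquiv hF₁ hsq₁ hF₂ hsq₂ Ψ hΨ).obj X).out) (B := ((mapOfEquiv hF₁ hsq₁ hF₂ hsq₂ Ψ hΨ).obj Y).out)
    (isLinear_mapOfEquiv_map hF₁ hsq₁ hF₂ hsq₂ Ψ hΨ hlin (A := X.out) (B := Y.out)
      (isLinear_of_isPullbackMorphism_toElemZero hiso₁ (A := X.out) (B := Y.out) hδ))

/-- **[FrdI] Cor. 4.11 (ii), sub-node L11, for EVERY equivalence `E` of THE birationalizations lying over
`Ψ`** (the quantifier of the named fact `FrdI.BiratEquivPreservesUnits`; p. 93 ll. 30–46 with the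
1-uniqueness of `Ψ^birat`, Cor. 4.10 p. 91): `E` and `E⁻¹` carry `O^×(−)` of `C₁^birat → F_{0_{D₁}}` resp.
`C₂^birat → F_{0_{D₂}}` into `O^×(−)`. Printed inputs as NAMED HYPOTHESES about `Ψ^birat = mapOfEquiv Ψ` and
`(Ψ⁻¹)^birat = mapOfEquiv Ψ⁻¹`: `hΨ`/`hΨ'` — `Ψ`, `Ψ⁻¹` preserve co-angular pre-steps (Thm. 3.4 (ii)); `hds₁`/`hds₂`
— `D_i` Div-slim relative to `Φ_i` (Cor. 4.11 setting); `hpb`/`hpb'` — `Ψ^birat`, `(Ψ⁻¹)^birat` carry pull-back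
morphisms to pull-back morphisms (p. 93 ll. 31–35: base-isomorphisms, sub-node L10, + Prop. 1.7 (ii));
`h42`/`h42'` — they carry endomorphisms projecting to `Φ`-identity automorphisms of the base to such (Thm. 4.2
(ii) with perf-factorial, non-dilating `Φ_i`); Def. 1.3 (i)(c) for the `C_i^birat` is PROVED above
(`pullbackSliceToBase_toElemZero_isEquivalence`). Reduction: `E ≅ Ψ^birat`, `E⁻¹ ≅ (Ψ⁻¹)^birat`
(`nonempty_iso_mapOfEquiv`, `oneCommutes_inverse_of_over`), invariance of the two transported properties
under isomorphism of functors, and abc-iut-L1-d4's relative transport `mapIso_mem_unitsSubgroup_of_pull_eq`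
applied to `E` and to `E.symm`. [cite: MochizukiFrdI2008, Cor. 4.11 (ii) p.93] -/
theorem mapIso_mem_unitsSubgroup_of_over (hF₁ : IsFrobenioid F₁) (hsq₁ : HasBiratSquares F₁)
    (hF₂ : IsFrobenioid F₂) (hsq₂ : HasBiratSquares F₂) (Ψ : C₁ ≌ C₂)
    (hΨ : ∀ ⦃A B : C₁⦄ (f : A ⟶ B), IsCoAngularPreStep F₁ f → IsCoAngularPreStep F₂ (Ψ.functor.map f))
    (hΨ' : ∀ ⦃A B : C₂⦄ (f : A ⟶ B), IsCoAngularPreStep F₂ f → IsCoAngularPreStep F₁ (Ψ.inverse.map f))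
    (hds₁ : (PreFrobenioidData.ofFunctor Φ₁ F₁).IsDivSlim) (hds₂ : (PreFrobenioidData.ofFunctor Φ₂ F₂).IsDivSlim)
    (hpb : ∀ ⦃X Y : Birat F₁ hF₁ hsq₁⦄ (δ : X ⟶ Y), IsPullbackMorphism (Birat.toElemZero hF₁ hsq₁) δ →
      IsPullbackMorphism (Birat.toElemZero hF₂ hsq₂) ((mapOfEquiv hF₁ hsq₁ hF₂ hsq₂ Ψ hΨ).map δ))
    (hpb' : ∀ ⦃X Y : Birat F₂ hF₂ hsq₂⦄ (δ : X ⟶ Y), IsPullbackMorphism (Birat.toElemZero hF₂ hsq₂) δ →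
      IsPullbackMorphism (Birat.toElemZero hF₁ hsq₁) ((mapOfEquiv hF₂ hsq₂ hF₁ hsq₁ Ψ.symm hΨ').map δ))
    (h42 : ∀ (X : Birat F₁ hF₁ hsq₁) (φ : X ⟶ X),
      pull Φ₁ (Base (Birat.toElemZero hF₁ hsq₁) φ) = MonoidHom.id _ →
        pull Φ₂ (Base (Birat.toElemZero hF₂ hsq₂) ((mapOfEquiv hF₁ hsq₁ hF₂ hsq₂ Ψ hΨ).map φ)) =
          MonoidHom.id _)
    (h42' : ∀ (Y : Birat F₂ hF₂ hsq₂) (φ : Y ⟶ Y),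
      pull Φ₂ (Base (Birat.toElemZero hF₂ hsq₂) φ) = MonoidHom.id _ →
        pull Φ₁ (Base (Birat.toElemZero hF₁ hsq₁) ((mapOfEquiv hF₂ hsq₂ hF₁ hsq₁ Ψ.symm hΨ').map φ)) =
          MonoidHom.id _)
    (E : Birat F₁ hF₁ hsq₁ ≌ Birat F₂ hF₂ hsq₂)
    (sq : toBirat F₁ hF₁ hsq₁ ⋙ E.functor ≅ Ψ.functor ⋙ toBirat F₂ hF₂ hsq₂) :
    (∀ (X : Birat F₁ hF₁ hsq₁) (u : Aut X), u ∈ unitsSubgroup (Birat.toElemZero hF₁ hsq₁) X →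
        E.functor.mapIso u ∈ unitsSubgroup (Birat.toElemZero hF₂ hsq₂) (E.functor.obj X)) ∧
      ∀ (Y : Birat F₂ hF₂ hsq₂) (u : Aut Y), u ∈ unitsSubgroup (Birat.toElemZero hF₂ hsq₂) Y →
        E.inverse.mapIso u ∈ unitsSubgroup (Birat.toElemZero hF₁ hsq₁) (E.inverse.obj Y) := by
  -- `E ≅ Ψ^birat`, `E⁻¹ ≅ (Ψ⁻¹)^birat` (1-uniqueness of the lift along the localization, Cor. 4.10)
  obtain ⟨ηF⟩ := nonempty_iso_mapOfEquiv hF₁ hsq₁ hF₂ hsq₂ Ψ hΨ E.functor ⟨sq.symm⟩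
  obtain ⟨ηI⟩ := nonempty_iso_mapOfEquiv hF₂ hsq₂ hF₁ hsq₁ Ψ.symm hΨ' E.inverse
    (oneCommutes_inverse_of_over hF₁ hsq₁ hF₂ hsq₂ Ψ E sq)
  -- the two transported properties, for `E` and `E⁻¹`
  have hpbE : ∀ ⦃X Y : Birat F₁ hF₁ hsq₁⦄ (δ : X ⟶ Y), IsPullbackMorphism (Birat.toElemZero hF₁ hsq₁) δ →
      IsPullbackMorphism (Birat.toElemZero hF₂ hsq₂) (E.functor.map δ) :=
    map_isPullbackMorphism_of_natIso _ _ ηF.symm hpb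
  have hpbI : ∀ ⦃X Y : Birat F₂ hF₂ hsq₂⦄ (δ : X ⟶ Y), IsPullbackMorphism (Birat.toElemZero hF₂ hsq₂) δ →
      IsPullbackMorphism (Birat.toElemZero hF₁ hsq₁) (E.inverse.map δ) :=
    map_isPullbackMorphism_of_natIso _ _ ηI.symm hpb'
  have h42E : ∀ (X : Birat F₁ hF₁ hsq₁) (φ : X ⟶ X),
      pull Φ₁ (Base (Birat.toElemZero hF₁ hsq₁) φ) = MonoidHom.id _ →
        pull Φ₂ (Base (Birat.toElemZero hF₂ hsq₂) (E.functor.map φ)) = MonoidHom.id _ :=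
    pull_base_map_of_natIso (Φ₁ := Φ₁) (Φ₂ := Φ₂) _ _ ηF.symm h42
  have h42I : ∀ (Y : Birat F₂ hF₂ hsq₂) (φ : Y ⟶ Y),
      pull Φ₂ (Base (Birat.toElemZero hF₂ hsq₂) φ) = MonoidHom.id _ →
        pull Φ₁ (Base (Birat.toElemZero hF₁ hsq₁) (E.inverse.map φ)) = MonoidHom.id _ :=
    pull_base_map_of_natIso (Φ₁ := Φ₂) (Φ₂ := Φ₁) _ _ ηI.symm h42'
  -- Div-slimness in the form of the relative transport
  have hds₁' : ∀ (X : D₁) (α : Aut (Over.forget X)),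
      (∀ (V : Over X) (x : Φ₁.obj (op V.left)), pull Φ₁ (α.hom.app V) x = x) → α = 1 :=
    fun X α h => hds₁.eq_one X α fun V x => h V x
  have hds₂' : ∀ (Y : D₂) (α : Aut (Over.forget Y)),
      (∀ (V : Over Y) (x : Φ₂.obj (op V.left)), pull Φ₂ (α.hom.app V) x = x) → α = 1 :=
    fun Y α h => hds₂.eq_one Y α fun V x => h V x
  refine ⟨fun X u hu => ?_, fun Y u hu => ?_⟩
  · exact mapIso_mem_unitsSubgroup_of_pull_eq (Φ₁ := Φ₁) (Φ₂ := Φ₂) (Birat.toElemZero hF₁ hsq₁)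
      (Birat.toElemZero hF₂ hsq₂) E (pullbackSliceToBase_toElemZero_isEquivalence hF₂ hsq₂) hds₂'
      (fun δ hδ => hpbI δ hδ) h42E u hu
  · exact mapIso_mem_unitsSubgroup_of_pull_eq (Φ₁ := Φ₂) (Φ₂ := Φ₁) (Birat.toElemZero hF₂ hsq₂)
      (Birat.toElemZero hF₁ hsq₁) E.symm (pullbackSliceToBase_toElemZero_isEquivalence hF₁ hsq₁) hds₁'
      (fun δ hδ => hpbE δ hδ) h42I u hu

/-- **The same in print's reduced case** (isotropic type — the `Thm42Setting` of the named fact; p. 92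
ll. 1–8): the pull-back inputs are discharged by `isPullbackMorphism_mapOfEquiv_map`, so that for EVERY
equivalence `E` of the birationalizations over `Ψ`, `E` and `E⁻¹` preserve `O^×(−)`, given only: `Ψ`, `Ψ⁻¹`
preserve co-angular pre-steps and linear morphisms (Thm. 3.4 (ii), (iii)), `D_i` Div-slim, and the Thm. 4.2
(ii) transport of `Φ`-identity endomorphisms along `Ψ^birat`, `(Ψ⁻¹)^birat` (the one remaining named input).
[cite: MochizukiFrdI2008, Cor. 4.11 (ii) p.93] -/
theorem mapIso_mem_unitsSubgroup_of_over_of_isotropic (hF₁ : IsFrobenioid F₁) (hsq₁ : HasBiratSquares F₁)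
    (hF₂ : IsFrobenioid F₂) (hsq₂ : HasBiratSquares F₂) (Ψ : C₁ ≌ C₂)
    (hiso₁ : IsOfIsotropicType F₁) (hiso₂ : IsOfIsotropicType F₂)
    (hΨ : ∀ ⦃A B : C₁⦄ (f : A ⟶ B), IsCoAngularPreStep F₁ f → IsCoAngularPreStep F₂ (Ψ.functor.map f))
    (hΨ' : ∀ ⦃A B : C₂⦄ (f : A ⟶ B), IsCoAngularPreStep F₂ f → IsCoAngularPreStep F₁ (Ψ.inverse.map f))
    (hlin : ∀ ⦃A B : C₁⦄ (f : A ⟶ B), IsLinear F₁ f → IsLinear F₂ (Ψ.functor.map f))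
    (hlin' : ∀ ⦃A B : C₂⦄ (f : A ⟶ B), IsLinear F₂ f → IsLinear F₁ (Ψ.inverse.map f))
    (hds₁ : (PreFrobenioidData.ofFunctor Φ₁ F₁).IsDivSlim) (hds₂ : (PreFrobenioidData.ofFunctor Φ₂ F₂).IsDivSlim)
    (h42 : ∀ (X : Birat F₁ hF₁ hsq₁) (φ : X ⟶ X),
      pull Φ₁ (Base (Birat.toElemZero hF₁ hsq₁) φ) = MonoidHom.id _ →
        pull Φ₂ (Base (Birat.toElemZero hF₂ hsq₂) ((mapOfEquiv hF₁ hsq₁ hF₂ hsq₂ Ψ hΨ).map φ)) =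
          MonoidHom.id _)
    (h42' : ∀ (Y : Birat F₂ hF₂ hsq₂) (φ : Y ⟶ Y),
      pull Φ₂ (Base (Birat.toElemZero hF₂ hsq₂) φ) = MonoidHom.id _ →
        pull Φ₁ (Base (Birat.toElemZero hF₁ hsq₁) ((mapOfEquiv hF₂ hsq₂ hF₁ hsq₁ Ψ.symm hΨ').map φ)) =
          MonoidHom.id _)
    (E : Birat F₁ hF₁ hsq₁ ≌ Birat F₂ hF₂ hsq₂)
    (sq : toBirat F₁ hF₁ hsq₁ ⋙ E.functor ≅ Ψ.functor ⋙ toBirat F₂ hF₂ hsq₂) :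
    (∀ (X : Birat F₁ hF₁ hsq₁) (u : Aut X), u ∈ unitsSubgroup (Birat.toElemZero hF₁ hsq₁) X →
        E.functor.mapIso u ∈ unitsSubgroup (Birat.toElemZero hF₂ hsq₂) (E.functor.obj X)) ∧
      ∀ (Y : Birat F₂ hF₂ hsq₂) (u : Aut Y), u ∈ unitsSubgroup (Birat.toElemZero hF₂ hsq₂) Y →
        E.inverse.mapIso u ∈ unitsSubgroup (Birat.toElemZero hF₁ hsq₁) (E.inverse.obj Y) :=
  mapIso_mem_unitsSubgroup_of_over hF₁ hsq₁ hF₂ hsq₂ Ψ hΨ hΨ' hds₁ hds₂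
    (isPullbackMorphism_mapOfEquiv_map hF₁ hsq₁ hF₂ hsq₂ Ψ hΨ hiso₁ hiso₂ hlin)
    (isPullbackMorphism_mapOfEquiv_map hF₂ hsq₂ hF₁ hsq₁ Ψ.symm hΨ' hiso₂ hiso₁ hlin') h42 h42' E sq

end Birat

end PreFrobenioid

end Literature.AlgebraicGeometry.Frobenioids
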